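import Summits.QuantumFields.YangMills.Theorems.ColdStartUniversalityLatticeLangevinLatitudeGenerator
import Summits.QuantumFields.YangMills.Theorems.ColdStartUniversalityLatticeLangevinLatitudeODE
import HarnessLib

/-!
# Route `ColdStartUniversality`, crux K_A1 `UniformColdStartMixing` (stmt-QuantumFields-24809), rung `stub_fixedCutoffMixing`:
# G-block, brick G3 — ridge products are eigenfunctions of the `β' = 0` coordinate generator

Helper file (seat `ym-line-csu-p1`, g7).  At every group point `V ∈ SU(2)^E` the coordinate generator of the SZZ system at
`β' = 0` (the form appearing in `dynkin_expectation_szz`) applied to the ridge product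
`F(y) = ∏_e U_{m_e}(lat_g(y)_e)`, `lat_g(y)_e = ⟨ρ g_e, y_e⟩/2`, equals `-λ_m F(coords V)`, `λ_m = Σ_e m_e(m_e+2)/2`
(`generator_ridge_beta_zero`; `generator_latitude` at `β = 0` and the Jacobi equation `jacobi_prod_gegenbauer`).  This is the
pointwise identity behind `integral_prod_gegenbauer_latitude`, isolated for the ground-state (super)solution arguments.
No definition, no sorry.  RECORD-rung R3 plumbing; nothing here bears on the mass gap.
-/

set_option autoImplicit false

noncomputable section

namespace Summit.QuantumFields.YangMills.Theorems.ColdStartUniversality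

open Finset
open scoped BigOperators
open Literature.MathematicalPhysics.QuantumFieldTheory Literature.Analysis.SpecialFunctions
open Literature.MathematicalPhysics.QuantumLattice (fundamentalRep fundamentalLatticeRep)

variable {L : ℕ} [NeZero L]

/-- **Ridge products are eigenfunctions of the `β' = 0` coordinate generator** at group points:
`𝓛_0 (∏_e U_{m_e} ∘ lat_g)(coords V) = -(Σ_e m_e(m_e+2)/2) ∏_e U_{m_e}(lat_g(coords V)_e)`. [folklore] -/
theorem generator_ridge_beta_zero (g V : Edge 3 L → Matrix.specialUnitaryGroup (Fin 2) ℂ) (m : Edge 3 L → ℕ) :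
    let x : (Edge 3 L × Fin 2 × Fin 2 × Bool) → ℝ := fun q =>
      (fun z : ℂ => if q.2.2.2 then z.im else z.re)
        ((fundamentalRep (Fin 2) (V q.1) : Matrix (Fin 2) (Fin 2) ℂ) q.2.1 q.2.2.1)
    let b : (Edge 3 L × Fin 2 × Fin 2 × Bool) → ℝ := fun q =>
      (fun z : ℂ => if q.2.2.2 then z.im else z.re) ((latticeLangevinDynamics (fundamentalLatticeRep 2) 0).drift
        (matrixConfig (fundamentalRep (Fin 2)) V) q.1 q.2.1 q.2.2.1)
    let σ : (Edge 3 L × Fin 2 × Fin 2 × Bool) → (Edge 3 L × NoiseIdx 2) → ℝ := fun q k =>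
      if k.1 = q.1 then (fun z : ℂ => if q.2.2.2 then z.im else z.re)
        ((latticeLangevinDynamics (fundamentalLatticeRep 2) 0).noise
          (matrixConfig (fundamentalRep (Fin 2)) V) q.1 k.2 q.2.1 q.2.2.1) else 0
    let lat : ((Edge 3 L × Fin 2 × Fin 2 × Bool) → ℝ) → (Edge 3 L → ℝ) := fun y e =>
      (∑ i, ∑ j, (((fundamentalRep (Fin 2) (g e) : Matrix (Fin 2) (Fin 2) ℂ) i j).re * y (e, i, j, false) +
        ((fundamentalRep (Fin 2) (g e) : Matrix (Fin 2) (Fin 2) ℂ) i j).im * y (e, i, j, true))) / 2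
    let f : ((Edge 3 L × Fin 2 × Fin 2 × Bool) → ℝ) → ℝ := fun y => ∏ e, gegenbauerSum 1 (m e) (lat y e)
    (∑ i, fderiv ℝ f x (Pi.single i 1) * b i +
      (1 / 2) * ∑ i, ∑ j, fderiv ℝ (fun z => fderiv ℝ f z (Pi.single i 1)) x (Pi.single j 1) * ∑ n, σ i n * σ j n) =
    -(∑ e, (m e : ℝ) * ((m e : ℝ) + 2) / 2) * f x := by
  intro x b σ lat f
  classical
  have hΦ2 : ContDiff ℝ 2 (fun s : Edge 3 L → ℝ => ∏ e, gegenbauerSum 1 (m e) (s e)) :=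
    contDiff_prod (fun e _ => (contDiff_gegenbauerSum 1 (m e)).comp (contDiff_apply ℝ ℝ e))
  obtain ⟨hxs, hG⟩ := generator_latitude (L := L) 0 g V (Φ := fun s : Edge 3 L → ℝ => ∏ e, gegenbauerSum 1 (m e) (s e)) hΦ2
  dsimp only at hxs hG
  have hf : f = fun y => (fun s : Edge 3 L → ℝ => ∏ e, gegenbauerSum 1 (m e) (s e)) (lat y) := rfl
  rw [hf, hG]
  have hdrift : ∀ e, hsForm (fundamentalLatticeRep 2).N ((fundamentalLatticeRep 2).ρ (g e))
      ((fundamentalLatticeRep 2).driftLie 0 (matrixConfig (fundamentalLatticeRep 2).ρ V) e *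
        (fundamentalLatticeRep 2).ρ (V e)) / 2 = 0 := by
    intro e
    have h0 : (fundamentalLatticeRep 2).driftLie 0 (matrixConfig (fundamentalLatticeRep 2).ρ V) e = 0 := by
      unfold LatticeRep.driftLie; exact zero_smul ℝ _
    rw [h0, Matrix.zero_mul, map_zero, zero_div]
  simp_rw [hdrift]
  rw [jacobi_prod_gegenbauer m]
  first
    | rfl
    | (rw [show lat x = fun e => hsForm 2 (fundamentalRep (Fin 2) (g e)) (fundamentalRep (Fin 2) (V e)) / 2 from hxs])

end Summit.QuantumFields.YangMills.Theorems.ColdStartUniversality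

end
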